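import Summits.Ventures.HodgeRepro2.T5SU11KernelCompositionDerivative
import Summits.Ventures.HodgeRepro2.T5SU11ResolventDerivativeMu

/-!
# The iterated derivatives of the kernel: `∂ᵏ_μ K_μ(t, s) = k! K_μ^{∘(k+1)}(t, s)`

Row 579 gives `∂_λ K_λ^{∘(n+1)} = (2λ − 2)(n + 1) K_λ^{∘(n+2)}` for the composed kernels `K_λ^{∘(n+1)}(t, s) = (G^I_λ)ⁿ K_λ(·, s)(t)`.
In the variable `μ` (`λ = 1 + √(μ + 1)`, `dλ/dμ = 1/(2(λ − 1))`) this is `∂_μ K_μ^{∘(n+1)} = (n + 1) K_μ^{∘(n+2)}`, and iterating: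

* `hasDerivAt_kernel_comp_mu` — **`∂_μ K_μ^{∘(n+1)}(t, s) = (n + 1) K_μ^{∘(n+2)}(t, s)`** at every `μ₂ > −1`;
* `iteratedDeriv_kernel_mu` — **`iteratedDeriv k (μ ↦ K_{λ(μ)}(t, s)) μ₂ = k! · (G^I_{λ(μ₂)})^k K_{λ(μ₂)}(·, s)(t)`** for every
  `k` and `μ₂ > −1` — the Taylor coefficients of the kernel are its composed kernels, exactly the coefficients of row 577's
  power series `K_λ = Σ (μ − μ₂)^k K_{λ₂}^{∘(k+1)}`;
* `iteratedDeriv_kernel_mu'` — the same at `μ₂ = λ₂(λ₂ − 2)`.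

Nothing is claimed about (N).

Blind lane: Mathlib + the HodgeRepro2 prefix only; no sorry; axioms ⊆ {propext, Classical.choice,
Quot.sound}.
-/

namespace Summit.Ventures.HodgeRepro2.T5SU11KernelIteratedDerivative

open Filter Topology MeasureTheory
open Set (Ioi Ioc)
open T5SU11Cartan T5SU11SphericalFunction T5SU11SphericalDecay T5SU11RadialGreenKernel T5SU11RadialGreenImproper
  T5SU11ResolventDerivativeMu T5SU11KernelCompositionDerivative

section measure

variable [MeasurableSpace Circle] [BorelSpace Circle]

variable {s : ℝ} (hs : 0 < s)

include hs in
/-- **`∂_μ K_μ^{∘(n+1)}(t, s) = (n + 1) K_μ^{∘(n+2)}(t, s)`**: `μ ↦ (G^I_{λ(μ)})ⁿ K_{λ(μ)}(·, s)(t)` has the derivative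
`(n + 1) · (G^I_{λ(μ₂)})^{n+1} K_{λ(μ₂)}(·, s)(t)` at every `μ₂ > −1` (`t > 0`). -/
theorem hasDerivAt_kernel_comp_mu (n : ℕ) {μ₂ : ℝ} (hμ₂ : -1 < μ₂) {t : ℝ} (ht : 0 < t) :
    HasDerivAt (fun μ => ((greenSolI (fun t => sph (1 + Real.sqrt (μ + 1)) (hyp t))
        (sphDecay (1 + Real.sqrt (μ + 1))))^[n] (fun r => sphGreenKernel (1 + Real.sqrt (μ + 1)) r s)) t)
      ((n + 1 : ℕ) * ((greenSolI (fun t => sph (1 + Real.sqrt (μ₂ + 1)) (hyp t))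
        (sphDecay (1 + Real.sqrt (μ₂ + 1))))^[n + 1] (fun r => sphGreenKernel (1 + Real.sqrt (μ₂ + 1)) r s)) t) μ₂ := by
  set lam₂ := 1 + Real.sqrt (μ₂ + 1) with hlam₂def
  have hlam₂ : 1 < lam₂ := one_lt_one_add_sqrt hμ₂
  have hinner := hasDerivAt_one_add_sqrt hμ₂
  have houter := hasDerivAt_kernel_comp_lam hlam₂ hs n ht
  have hcomp := houter.comp μ₂ hinner
  refine hcomp.congr_deriv ?_
  have hsqrt : Real.sqrt (μ₂ + 1) = lam₂ - 1 := by rw [hlam₂def]; ring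
  have hpos : 0 < Real.sqrt (μ₂ + 1) := Real.sqrt_pos.mpr (by linarith)
  have h2 : 2 * Real.sqrt (μ₂ + 1) ≠ 0 := by positivity
  rw [show (2 * lam₂ - 2) = 2 * Real.sqrt (μ₂ + 1) by rw [hsqrt]; ring, mul_one_div,
    mul_div_cancel_left₀ _ h2]

include hs in
/-- **THE ITERATED DERIVATIVES OF THE KERNEL**: `iteratedDeriv k (μ ↦ K_{λ(μ)}(t, s)) μ₂ = k! · (G^I_{λ(μ₂)})^k K_{λ(μ₂)}(·, s)(t)`
for every `k` and `μ₂ > −1` — `∂ᵏ_μ K_μ = k! K_μ^{∘(k+1)}`. -/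
theorem iteratedDeriv_kernel_mu (k : ℕ) {μ₂ : ℝ} (hμ₂ : -1 < μ₂) {t : ℝ} (ht : 0 < t) :
    iteratedDeriv k (fun μ => sphGreenKernel (1 + Real.sqrt (μ + 1)) t s) μ₂
      = (k.factorial : ℝ) * ((greenSolI (fun t => sph (1 + Real.sqrt (μ₂ + 1)) (hyp t))
        (sphDecay (1 + Real.sqrt (μ₂ + 1))))^[k] (fun r => sphGreenKernel (1 + Real.sqrt (μ₂ + 1)) r s)) t := by
  suffices h : ∀ μ₂ : ℝ, -1 < μ₂ → iteratedDeriv k (fun μ => sphGreenKernel (1 + Real.sqrt (μ + 1)) t s) μ₂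
      = (k.factorial : ℝ) * ((greenSolI (fun t => sph (1 + Real.sqrt (μ₂ + 1)) (hyp t))
        (sphDecay (1 + Real.sqrt (μ₂ + 1))))^[k] (fun r => sphGreenKernel (1 + Real.sqrt (μ₂ + 1)) r s)) t from h μ₂ hμ₂
  induction k with
  | zero =>
    intro μ₂ _
    simp
  | succ k ih =>
    intro μ₂ hμ₂
    rw [iteratedDeriv_succ]
    have hev : (iteratedDeriv k (fun μ => sphGreenKernel (1 + Real.sqrt (μ + 1)) t s))
        =ᶠ[𝓝 μ₂] fun μ => (k.factorial : ℝ) * ((greenSolI (fun t => sph (1 + Real.sqrt (μ + 1)) (hyp t))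
          (sphDecay (1 + Real.sqrt (μ + 1))))^[k] (fun r => sphGreenKernel (1 + Real.sqrt (μ + 1)) r s)) t := by
      filter_upwards [eventually_gt_nhds hμ₂] with μ hμ
      exact ih μ hμ
    rw [hev.deriv_eq]
    have hd := (hasDerivAt_kernel_comp_mu hs k hμ₂ ht).const_mul (k.factorial : ℝ)
    rw [hd.deriv]
    push_cast [Nat.factorial_succ]
    ring

include hs in
/-- The iterated derivatives of the kernel at `μ₂ = λ₂(λ₂ − 2)`, `λ₂ > 1`:
`iteratedDeriv k (μ ↦ K_{λ(μ)}(t, s)) (λ₂(λ₂ − 2)) = k! · (G^I_{λ₂})^k K_{λ₂}(·, s)(t)`. -/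
theorem iteratedDeriv_kernel_mu' (k : ℕ) {lam₂ : ℝ} (hlam₂ : 1 < lam₂) {t : ℝ} (ht : 0 < t) :
    iteratedDeriv k (fun μ => sphGreenKernel (1 + Real.sqrt (μ + 1)) t s) (lam₂ * (lam₂ - 2))
      = (k.factorial : ℝ) * ((greenSolI (fun t => sph lam₂ (hyp t)) (sphDecay lam₂))^[k]
        (fun r => sphGreenKernel lam₂ r s)) t := by
  have hμ₂ : -1 < lam₂ * (lam₂ - 2) := by nlinarith
  rw [iteratedDeriv_kernel_mu hs k hμ₂ ht, one_add_sqrt_eq hlam₂]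

end measure

end Summit.Ventures.HodgeRepro2.T5SU11KernelIteratedDerivative
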